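import Literature.Computability.MetaComplexity.ScopeExpansion

/-!
# PneNP / ExpanderLinearGenerators — the column-weight-two slice of the crux: definitions

Route `PneNP/ExpanderLinearGenerators`, support for crux stmt-PneNP-11443
(`LinearGeneratorDepthFregeHard`). For a family of scopes `S : ι → Finset ℕ` (the supports of the
rows of a linear system, read in `ℕ`) in which every point lies in at most two scopes, the rows form
a multigraph: two rows are ADJACENT when their scopes meet, a point lying in two rows of a row set
`W` is an INNER EDGE of `W`. This file fixes the vocabulary of the routing argument
(`…ColumnTwoExtract`, `…ColumnTwoMinor`, `…ColumnTwoTransfer`): inner edges, the edges a subset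
touches, neighbourhoods and balls inside an ambient row set, connected row sets.

References: M. Krivelevich, SIAM J. Discrete Math. 32 (2018) (arXiv:1704.00465), Theorem 1;
M. Krivelevich, B. Sudakov, GAFA 19 (2009), §4; E. Ben-Sasson, Comput. Complexity 11 (2002).
-/

namespace Summit.PneNP.PneNP.Theorems.ColumnTwo

open Finset Literature.Computability.MetaComplexity

variable {ι : Type*} [DecidableEq ι] (S : ι → Finset ℕ)

/-- The INNER EDGES of a row set `W`: points lying in at least two rows of `W`. -/
def inner (W : Finset ι) : Finset ℕ :=
  (cover S W).filter fun v => 2 ≤ coverDegree S W v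

/-- The number `e(W)` of inner edges of `W`. -/
def eIn (W : Finset ι) : ℕ := (inner S W).card

/-- The CUT of `W` inside the ambient row set `U`: points with exactly one row in `W` and exactly
one row in `U \\ W`. -/
def cut (U W : Finset ι) : Finset ℕ :=
  (boundary S W).filter fun v => coverDegree S (U \ W) v = 1

/-- The rows of `U` outside `W` adjacent to `W` (external neighbourhood inside `U`). -/
def nbr (U W : Finset ι) : Finset ι :=
  (U \ W).filter fun j => ∃ i ∈ W, (S i ∩ S j).Nonempty

/-- The ball of radius `t` around `W` inside `U`. -/
def ball (U : Finset ι) (W : Finset ι) : ℕ → Finset ι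
  | 0 => W
  | t + 1 => ball U W t ∪ nbr S U (ball U W t)

/-- A row set is CONNECTED: every nonempty proper subset has a neighbour in the rest. -/
def IsConn (B : Finset ι) : Prop :=
  ∀ W ⊆ B, W.Nonempty → W ≠ B → (nbr S B W).Nonempty

/-- `parityForm b xs`: a formula for `b ⊕ ⨁_{x ∈ xs} x` in the basis `¬, ∧, ∨`
(`(x ∧ ¬R) ∨ (¬x ∧ R)` recursively); the shape of the routing substitution. (Same gadget as
`Literature.Computability.MetaComplexity.xorForm`.) -/
def parityForm (b : Bool) : List ℕ → Literature.Computability.Complexity.PropForm ℕ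
  | [] => .const b
  | x :: xs => .disj (.conj (.var x) (.neg (parityForm b xs)))
      (.conj (.neg (.var x)) (parityForm b xs))

/-- The density threshold of level `i` of the extraction, as a fraction
`θ i = (498 (i+1) + 1) / (1000 (i+1))`: numerator. -/
def thetaNum (i : ℕ) : ℕ := 498 * (i + 1) + 1

/-- The density threshold of level `i`: denominator. -/
def thetaDen (i : ℕ) : ℕ := 1000 * (i + 1)

end Summit.PneNP.PneNP.Theorems.ColumnTwo
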